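import Mathlib
import Summits.KontsevichZagierPeriods.Zeta5Search.Families.GapGaugeExchange
import HarnessLib

/-!
# ζ(5) search — Families: GAUGE INVARIANCE of dual gap constant terms — the adjacent gauge move

HONEST FRAMING: systematic search; no irrationality claim unless certified.  Cell `pub-zeta5`, seat P2 g10 (Families
layer), 2026-08-23.  An identity between coefficients of integer polynomials; nothing about any zeta value; no record
moves; no conjecture node is used.

SETTING.  `M + 3` points on a circle in the cyclic order `0, 1, …, M+2` (the DUAL seating of a cellular integrand);
chord multiplicities `A u v ≥ 0` (`u < v`) and side multiplicities `B u ≥ 0` on the sides `{u, u+1}`.  A GAUGE sends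
one point to infinity; the remaining `M + 2` points span `M + 1` consecutive gaps `g₀, …, g_M`, every chord not through
`∞` becomes the sum of the gaps it spans, and the DUAL CONSTANT TERM of the gauge is the coefficient of
`∏ g_t^{B(side t)}` in the product of these spans (`GapRegime.endProd`, `GapRegime.gapVec`; P2 g6
`Families/DualConstantTerm`, cert-2 g10 `Families/CubicalChartVIM`, P2 g9 `Families/VIMTorusPeriodCoeff` are three
instances).
* TOP gauge: point `0` at infinity, finite points `1 < 2 < ⋯ < M+2`, gap `t` = side `{t+1, t+2}`;
* BOTTOM gauge: point `M+2` at infinity, finite points `0 < 1 < ⋯ < M+1`, gap `s` = side `{s, s+1}`.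

THEOREM (`GapRegime.gauge_move`).  If the multiplicities are BALANCED at every point finite in both gauges
(`Σ_{v} A{u,v} = B(u−1) + B u` for `1 ≤ u ≤ M+1`), the two dual constant terms are EQUAL:
`[∏_t g_t^{B(t+1)}] endProd (A (·+1) (·+1)) = [∏_s g_s^{B s}] endProd A`.
Iterating the move around the circle: the dual constant term of a balanced configuration does not depend on the
gauge (`Families/VIMGaugeInvariance` does the four moves `∞ = 10 → 2 → 4 → 1 → 6` of Brown's VIM plan).

PROOF (elementary; no series, no analysis).  Write the top positions as suffix sums `y_{t+1} = T_t = g_t + ⋯ + g_M`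
(`y_{M+2} = 0`) inside `K = Frac ℤ[g]`; the bottom gauge is the Möbius image `z = −1/y`: `z_0 = 0`,
`z_{t+1} = −1/T_t`, with gaps `h_0 = 1/T_0`, `h_{t+1} = g_t/(T_t T_{t+1})` and chord spans
`z_u − z_v = (y_u − y_v)·w_u·w_v`, `w = 1/y` (`w_0 = w_{M+2} = 1`).  Balance makes the vertex weights cancel, so
`endProd_top(g) · ∏ h^{B_bot} = endProd_bot(h(g)) · g^{B_top}` EXACTLY in `K` (`ι_top_mul_eq`).  Expanding
`endProd_bot = Σ_d c_d h^d` and clearing denominators gives a POLYNOMIAL identity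
`endProd_top · g^{a} · ∏ T^N = Σ_d c_d g^{B_top + a(d)} ∏ T^{N − c(d) + c(B_bot)}`; applying the regime functional
`Phi N (B_top + a)` (`Families/GapRegimePhi`: `Phi_mul_prod_T_pow`, `Phi_mul_monomial`, `Phi_zero_eq_coeff`) turns the
left side into the top coefficient and each right summand into `c_d · E(a(d−B_bot), c(d−B_bot)) = c_d · [d = B_bot]`
(`GapRegime.E_star`), i.e. into the bottom coefficient.
THIS FILE: `prod_h_pow_mul` (images of the bottom monomials), `poly_identity`, and the theorem **`gauge_move`**; the
exchange identity `ι_top_mul_eq` is `Families/GapGaugeExchange`.  Standard axioms only.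
-/

namespace Summit.KontsevichZagierPeriods.Zeta5Search.Families.Cellular

namespace GapRegime

open MvPolynomial Finset

variable {M : ℕ}

/-! ## Images of the bottom monomials, the polynomial identity, and the gauge move -/

section Final

variable {K : Type*} [Field K] (ι : MvPolynomial (Fin (M + 1)) ℤ →+* K) (hι : Function.Injective ι)
  (y z : ℕ → K) (h : Fin (M + 1) → K)
  (hy : ∀ k, y k = ι (spanPoly M k (M + 1)))
  (hz0 : z 0 = 0) (hz : ∀ t : Fin (M + 1), z (t.val + 1) = -(y t.val)⁻¹)
  (hh : ∀ s : Fin (M + 1), h s = z s.val - z (s.val + 1))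

include hy hι hz0 hz hh in
/-- **Image of a bottom monomial**: `h^d · ι(∏_i T_i^{d_i + a(d)_i}) = ι(g^{a(d)})` — the bottom gaps are
`h_0 = 1/T_0`, `h_{t+1} = g_t/(T_t T_{t+1})`. -/
theorem prod_h_pow_mul (d : Fin (M + 1) →₀ ℕ) :
    (∏ s : Fin (M + 1), h s ^ d s) * ι (∏ i : Fin (M + 1), T M i ^ (d i + aVec d i)) = ι (monomial (aVec d) 1) := by
  have hyT : ∀ t : Fin (M + 1), y t.val = ι (T M t) := fun t => y_eq_T ι y hy t
  have hyne : ∀ t : Fin (M + 1), ι (T M t) ≠ 0 := fun t => by rw [← hyT]; exact y_ne_zero ι hι y hy t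
  -- denominators `D` and numerators `Nn` of the bottom gaps
  let D : Fin (M + 1) → K :=
    Fin.cases (ι (T M 0)) (fun t => ι (T M t.castSucc) * ι (T M t.succ))
  let Nn : Fin (M + 1) → K :=
    Fin.cases 1 (fun t => ι (X t.castSucc))
  have hD0 : D 0 = ι (T M 0) := rfl
  have hDs : ∀ t : Fin M, D t.succ = ι (T M t.castSucc) * ι (T M t.succ) := fun t => rfl
  have hN0 : Nn 0 = 1 := rfl
  have hNs : ∀ t : Fin M, Nn t.succ = ι (X t.castSucc) := fun t => rfl
  -- `h_s · D_s = Nn_s`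
  have hstep : ∀ s : Fin (M + 1), h s * D s = Nn s := by
    intro s
    refine Fin.cases ?_ (fun t => ?_) s
    · have e := hz 0
      have e' := hh 0
      have e'' := hyT 0
      simp only [Fin.val_zero, zero_add] at e e' e''
      rw [hD0, hN0, e', hz0, zero_sub, e, neg_neg, e'']
      exact inv_mul_cancel₀ (hyne 0)
    · rw [hDs, hNs, hh, Fin.val_succ]
      have e1 : z (t.val + 1) = -(ι (T M t.castSucc))⁻¹ := by
        rw [← Fin.val_castSucc (i := t), hz t.castSucc, hyT]
      have e2 : z (t.val + 1 + 1) = -(ι (T M t.succ))⁻¹ := by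
        have := hz t.succ; rw [Fin.val_succ] at this; rw [this, ← Fin.val_succ, hyT]
      have e3 : ι (X t.castSucc) = ι (T M t.castSucc) - ι (T M t.succ) := by
        rw [← map_sub, T_eq_spanPoly, T_eq_spanPoly, spanPoly_anchor_succ t.castSucc, Fin.val_succ, Fin.val_castSucc,
          add_sub_cancel_right]
      rw [e1, e2, e3]
      have h1 := hyne t.castSucc
      have h2 := hyne t.succ
      field_simp
      ring
  -- `∏ D^d = ι ∏ T^{d + a(d)}`
  have hDprod : (∏ s : Fin (M + 1), D s ^ d s) = ι (∏ i : Fin (M + 1), T M i ^ (d i + aVec d i)) := by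
    rw [map_prod]
    simp only [map_pow, pow_add, map_mul]
    rw [Finset.prod_mul_distrib, Fin.prod_univ_succ (f := fun i => ι (T M i) ^ d i),
      Fin.prod_univ_castSucc (f := fun i => ι (T M i) ^ aVec d i), Fin.prod_univ_succ (f := fun s => D s ^ d s),
      aVec_apply_last, pow_zero, mul_one, hD0]
    simp only [hDs, mul_pow, Finset.prod_mul_distrib, aVec_apply_castSucc]
    ring
  -- `∏ Nn^d = ι (g^{a(d)})`
  have hNprod : (∏ s : Fin (M + 1), Nn s ^ d s) = ι (monomial (aVec d) 1) := by
    rw [monomial_eq, C_1, one_mul, Finsupp.prod_fintype _ _ (fun i => by simp), map_prod,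
      Fin.prod_univ_succ (f := fun s => Nn s ^ d s), Fin.prod_univ_castSucc (f := fun i => ι (X i ^ aVec d i)),
      hN0, one_pow, one_mul, map_pow, aVec_apply_last, pow_zero, mul_one]
    simp only [hNs, map_pow, aVec_apply_castSucc]
  rw [← hDprod, ← hNprod, ← Finset.prod_mul_distrib]
  exact Finset.prod_congr rfl fun s _ => by rw [← mul_pow, hstep]

include hy hι hz0 hz hh in
/-- **The polynomial identity** (denominators cleared):
`endProd_top · g^{a(B_bot)} · ∏ T^N = Σ_{d} [h^d]endProd_bot · g^{B_top + a(d)} · ∏ T^{N − c(d) + c(B_bot)}`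
with `c(d) = d + a(d)` and `N = Σ_d c(d)` over the support of `endProd_bot`. -/
theorem poly_identity (A : ℕ → ℕ → ℕ) (B : ℕ → ℕ)
    (hbal : ∀ u, 1 ≤ u → u ≤ M + 1 →
      (∑ v ∈ range (M + 3), if u < v then A u v else if v < u then A v u else 0) = B (u - 1) + B u) :
    endProd M (fun i j => A (i + 1) (j + 1)) * monomial (aVec (gapVec M B)) 1 *
        ∏ i : Fin (M + 1), T M i ^ (∑ d ∈ (endProd M A).support, (d i + aVec d i)) =
      ∑ d ∈ (endProd M A).support, coeff d (endProd M A) •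
        (monomial (gapVec M (fun t => B (t + 1)) + aVec d) 1 *
          ∏ i : Fin (M + 1), T M i ^ ((∑ d' ∈ (endProd M A).support, (d' i + aVec d' i)) - (d i + aVec d i) +
            (gapVec M B i + aVec (gapVec M B) i))) := by
  apply hι
  set bot := endProd M A with hbot
  set N : Fin (M + 1) → ℕ := fun i => ∑ d ∈ bot.support, (d i + aVec d i) with hN
  have hNge : ∀ d ∈ bot.support, ∀ i, d i + aVec d i ≤ N i := fun d hd i =>
    Finset.single_le_sum (f := fun d' : Fin (M + 1) →₀ ℕ => d' i + aVec d' i) (fun _ _ => Nat.zero_le _) hd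
  have hgap : (∏ s : Fin (M + 1), h s ^ (gapVec M B) s) = ∏ s : Fin (M + 1), h s ^ B s.val :=
    Finset.prod_congr rfl fun s _ => by simp [gapVec]
  -- left side
  have hL : ι (endProd M (fun i j => A (i + 1) (j + 1)) * monomial (aVec (gapVec M B)) 1 * ∏ i, T M i ^ N i) =
      MvPolynomial.aeval h bot * ι (monomial (gapVec M fun t => B (t + 1)) 1) *
        ι (∏ i, T M i ^ (gapVec M B i + aVec (gapVec M B) i)) * ι (∏ i, T M i ^ N i) := by
    rw [map_mul, map_mul, ← prod_h_pow_mul ι hι y z h hy hz0 hz hh (gapVec M B), hgap, ← mul_assoc,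
      ι_top_mul_eq ι hι y z h hy hz0 hz hh A B hbal]
  -- right side, termwise
  have hR : ∀ d ∈ bot.support, ι (coeff d bot • (monomial (gapVec M (fun t => B (t + 1)) + aVec d) 1 *
        ∏ i, T M i ^ (N i - (d i + aVec d i) + (gapVec M B i + aVec (gapVec M B) i)))) =
      ((coeff d bot : ℤ) : K) * (∏ s, h s ^ d s) *
        (ι (monomial (gapVec M fun t => B (t + 1)) 1) *
        ι (∏ i, T M i ^ (gapVec M B i + aVec (gapVec M B) i)) * ι (∏ i, T M i ^ N i)) := by
    intro d hd
    have hsplit : (∏ i, T M i ^ (N i - (d i + aVec d i) + (gapVec M B i + aVec (gapVec M B) i))) *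
        ∏ i, T M i ^ (d i + aVec d i) = (∏ i, T M i ^ (gapVec M B i + aVec (gapVec M B) i)) * ∏ i, T M i ^ N i := by
      rw [← Finset.prod_mul_distrib, ← Finset.prod_mul_distrib]
      refine Finset.prod_congr rfl fun i _ => ?_
      rw [← pow_add, ← pow_add]
      congr 1
      have := hNge d hd i
      omega
    have hmono : (monomial (gapVec M (fun t => B (t + 1)) + aVec d) (1 : ℤ) : MvPolynomial (Fin (M + 1)) ℤ) =
        monomial (gapVec M fun t => B (t + 1)) 1 * monomial (aVec d) 1 := by rw [monomial_mul, mul_one]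
    have hC : ι (C (coeff d bot)) = ((coeff d bot : ℤ) : K) := by
      rw [eq_intCast C, map_intCast]
    calc ι (coeff d bot • (monomial (gapVec M (fun t => B (t + 1)) + aVec d) 1 *
            ∏ i, T M i ^ (N i - (d i + aVec d i) + (gapVec M B i + aVec (gapVec M B) i))))
        = ((coeff d bot : ℤ) : K) *
            ι (monomial (gapVec M fun t => B (t + 1)) 1) * (ι (monomial (aVec d) 1) *
            ι (∏ i, T M i ^ (N i - (d i + aVec d i) + (gapVec M B i + aVec (gapVec M B) i)))) := by
          rw [MvPolynomial.smul_eq_C_mul, hmono, map_mul, map_mul, map_mul, hC]; ring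
      _ = ((coeff d bot : ℤ) : K) *
            ι (monomial (gapVec M fun t => B (t + 1)) 1) * ((∏ s, h s ^ d s) *
            (ι (∏ i, T M i ^ (N i - (d i + aVec d i) + (gapVec M B i + aVec (gapVec M B) i))) *
              ι (∏ i, T M i ^ (d i + aVec d i)))) := by
          rw [← prod_h_pow_mul ι hι y z h hy hz0 hz hh d]; ring
      _ = _ := by rw [← map_mul, hsplit, map_mul]; ring
  rw [hL, map_sum, Finset.sum_congr rfl hR, ← Finset.sum_mul, MvPolynomial.aeval_def, MvPolynomial.eval₂_eq']
  simp only [eq_intCast]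
  ring

include hy hι hz0 hz hh in
/-- The gauge move, with the field, the embedding and the position functions supplied. -/
theorem gauge_move_aux (A : ℕ → ℕ → ℕ) (B : ℕ → ℕ)
    (hbal : ∀ u, 1 ≤ u → u ≤ M + 1 →
      (∑ v ∈ range (M + 3), if u < v then A u v else if v < u then A v u else 0) = B (u - 1) + B u) :
    coeff (gapVec M fun t => B (t + 1)) (endProd M fun i j => A (i + 1) (j + 1)) = coeff (gapVec M B) (endProd M A) := by
  classical
  have hP := poly_identity ι hι y z h hy hz0 hz hh A B hbal
  set top := endProd M (fun i j => A (i + 1) (j + 1)) with htop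
  set bot := endProd M A with hbot
  set gB := gapVec M B with hgB
  set aB := aVec (gapVec M B) with haB
  set N : Fin (M + 1) → ℕ := fun i => ∑ d ∈ bot.support, (d i + aVec d i) with hN
  set Bt : Fin (M + 1) → ℕ := fun t => B (t.val + 1) with hBt
  have hNge : ∀ d ∈ bot.support, ∀ i, d i + aVec d i ≤ N i := fun d hd i =>
    Finset.single_le_sum (f := fun d' : Fin (M + 1) →₀ ℕ => d' i + aVec d' i) (fun _ _ => Nat.zero_le _) hd
  have hgapBt : (gapVec M fun t => B (t + 1)) = Finsupp.equivFunOnFinite.symm Bt := rfl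
  -- Step 1: the top coefficient is `Phi N (Bt + aB)` of the cleared left side
  have h1 : coeff (gapVec M fun t => B (t + 1)) top =
      Phi M (fun i => (N i : ℤ)) (Bt + ⇑aB) (top * monomial aB 1 * ∏ i, T M i ^ N i) := by
    rw [Phi_mul_prod_T_pow, hgapBt, ← Phi_zero_eq_coeff, Phi_mul_monomial]
    congr 1
    ext i; simp
  -- Step 2: each right summand evaluates to `c_d · [d = gB]`
  have h2 : ∀ d ∈ bot.support, Phi M (fun i => (N i : ℤ)) (Bt + ⇑aB)
      (coeff d bot • (monomial (gapVec M (fun t => B (t + 1)) + aVec d) 1 *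
        ∏ i, T M i ^ (N i - (d i + aVec d i) + (gB i + aB i)))) = if d = gB then coeff d bot else 0 := by
    intro d hd
    rw [map_zsmul, Phi_mul_prod_T_pow, Phi_monomial, one_mul, smul_eq_mul]
    -- the exponent data are those of `E_star` with `k = d − gB`
    set k : Fin (M + 1) → ℤ := fun i => (d i : ℤ) - (gB i : ℤ) with hk
    have hshift : shift (gapVec M (fun t => B (t + 1)) + aVec d) (Bt + ⇑aB) = fun i => (aVec d i : ℤ) - (aB i : ℤ) := by
      ext i
      simp only [shift, hgapBt, Finsupp.coe_add, Pi.add_apply, Finsupp.coe_equivFunOnFinite_symm]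
      push_cast; ring
    have hc : ((fun i => (N i : ℤ)) - fun i => ((N i - (d i + aVec d i) + (gB i + aB i) : ℕ) : ℤ)) =
        k + fun i => (aVec d i : ℤ) - (aB i : ℤ) := by
      ext i
      simp only [Pi.sub_apply, Pi.add_apply, hk]
      have := hNge d hd i
      push_cast [Nat.cast_sub (show d i + aVec d i ≤ N i - 0 from by omega)]
      omega
    rw [hshift, hc, E_star M k _ (fun t => by
      simp only [hk, haB, hgB, aVec_apply_castSucc])]
    have hiff : k = 0 ↔ d = gB := by
      constructor
      · intro h0; ext i; have := congrFun h0 i; simp only [hk, Pi.zero_apply] at this; omega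
      · intro h0; ext i; simp [hk, h0]
    by_cases hd' : d = gB
    · rw [if_pos (hiff.2 hd'), if_pos hd', mul_one]
    · rw [if_neg (fun h0 => hd' (hiff.1 h0)), if_neg hd', mul_zero]
  rw [h1, hP, map_sum, Finset.sum_congr rfl h2, Finset.sum_ite_eq']
  by_cases hmem : gB ∈ bot.support
  · rw [if_pos hmem]
  · rw [if_neg hmem]; exact (MvPolynomial.notMem_support_iff.1 hmem).symm

/-- **THE ADJACENT GAUGE MOVE.**  For chord multiplicities `A` and side multiplicities `B` on `M + 3` cyclically
ordered points, BALANCED at the points `1, …, M+1` (those finite in both gauges), the dual gap constant term with the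
point `0` at infinity (finite points `1 < ⋯ < M+2`, gap `t` = side `{t+1,t+2}` with exponent `B (t+1)`) equals the one
with the point `M+2` at infinity (finite points `0 < ⋯ < M+1`, gap `s` = side `{s,s+1}` with exponent `B s`). -/
theorem gauge_move (A : ℕ → ℕ → ℕ) (B : ℕ → ℕ)
    (hbal : ∀ u, 1 ≤ u → u ≤ M + 1 →
      (∑ v ∈ range (M + 3), if u < v then A u v else if v < u then A v u else 0) = B (u - 1) + B u) :
    coeff (gapVec M fun t => B (t + 1)) (endProd M fun i j => A (i + 1) (j + 1)) = coeff (gapVec M B) (endProd M A) := by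
  let ι := algebraMap (MvPolynomial (Fin (M + 1)) ℤ) (FractionRing (MvPolynomial (Fin (M + 1)) ℤ))
  have hι : Function.Injective ι := IsFractionRing.injective (MvPolynomial (Fin (M + 1)) ℤ) _
  let y : ℕ → FractionRing (MvPolynomial (Fin (M + 1)) ℤ) := fun k => ι (spanPoly M k (M + 1))
  let z : ℕ → FractionRing (MvPolynomial (Fin (M + 1)) ℤ) := fun k => if k = 0 then 0 else -(y (k - 1))⁻¹
  let h : Fin (M + 1) → FractionRing (MvPolynomial (Fin (M + 1)) ℤ) := fun s => z s.val - z (s.val + 1)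
  exact gauge_move_aux ι hι y z h (fun k => rfl) (by simp [z]) (fun t => by simp [z]) (fun s => rfl) A B hbal

end Final

end GapRegime

end Summit.KontsevichZagierPeriods.Zeta5Search.Families.Cellular
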